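import Summits.QuantumFields.YangMills.Theorems.BalabanUVNodesK0AxTangentSocketOntoOfProp4W
import HarnessLib

/-!
# NODE O · K0ᴬ — THE (R-a) ROAD OF ✓`rootedReceipts_of_tokens_atScale_recordScheme_of_prop4W` AT PRINT's CONCRETE `G′ = (Δ_{U₀} + a′·proj_{N(Q′♭)ᗮ})⁻¹`: the `G′` row («`G′` real and commuting
# with the scalar part») is DISCHARGED by ✓`printGreenOfRecord_starW` ∕ ✓`scalPartW_printGreenOfRecord`, so at the flat record scheme with print's `G′` the road displays ONLY N07's KNIT tokens,
# (R2) Prop. 4 for `W`, the small radii, the `Δ2` tokens, the chart letter and (J-crit′)∕(J-cons′) ([B9] (3.24)–(3.25) p. 394, (3.134) p. 422; [15] Prop. 4, Prop. 6, Prop. 9)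

Cell `pub-ymgap`, width seat `pub-ymgap-dag-n07-w3` (g27), CLAIM-16 — BY-NAME KNIT; `--kind proof --supports stmt-QuantumFields-27238 --as helper`; count-neutral.
[15] = [Balaban1985Variational]; [B9] = [Balaban1985BackgroundPropagators].

HONEST LABELS.  One application of ✓p826658 with the two `G′` rows supplied; existential non-uniform constants; KNIT tokens ∕ (R2) ∕ dictionaries DISPLAYED; `N = 2`, `U₀ = 1`; K0ᴬ NOT closed; N07 NOT
discharged; P0 ⟨26900⟩ OPEN; R4 is the conditional finite-𝕋⁴ rung only.  Nothing here is a claim about the Yang–Mills mass gap (`Summit.QuantumFields`): finite torus, fixed `ε`; nothing continuum ∕ OS ∕ Clay.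
-/

set_option autoImplicit false

noncomputable section

open Filter Topology
open scoped BigOperators Matrix.Norms.L2Operator InnerProductSpace

namespace Summit.QuantumFields.YangMills.Theorems.K0AxTangentSocketOntoOfProp4WPrintGreen

open Literature.MathematicalPhysics.QuantumFieldTheory.Balaban1983to89
open Literature.MathematicalPhysics.QuantumFieldTheory.Balaban1983to89.T4Continuum (T4Family)
open Literature.MathematicalPhysics.QuantumFieldTheory.Balaban1983to89.Node00
open B12GaugeOrbits021 (OrbitRel)
open B11Prop6Scheme (mapT)
open B13Contraction113 (QuadAnalytic)
open B11Eq103H1Complex (BondL2K SiteL2K covLaplaceSiteK greenK)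
open B15DeterminingSets (MSField avgFamily atScale)
open NormedSpace (exp)
open Summit.QuantumFields.YangMills.Theorems.K0RecordFormatNames
open Summit.QuantumFields.YangMills.Theorems.K0AxRootGrad
open Summit.QuantumFields.YangMills.Theorems.K0AxCtabUniq
open Summit.QuantumFields.YangMills.Theorems.N07FrakGOfRecordReality (printGreenOfRecord_starW)
open Summit.QuantumFields.YangMills.Theorems.N07SlotCTraceSectors (scalPartW_printGreenOfRecord)
open Summit.QuantumFields.YangMills.Theorems.K0AxTangentSocketOntoOfProp4W (rootedReceipts_of_tokens_atScale_recordScheme_of_prop4W)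

variable (F : T4Family) (θ : Stage13Params F 2) (k K : ℕ) [Fact (0 < (F.L : ℝ))] [Fact (0 < (F.P K).eta (k + 1))] [Fact (0 < c0Rec F K (k + 1))]
  [Fact (∀ c, 0 < wBRec F K (k + 1) c)]
  (Ω : ℕ → Set (Site (F.P K) 0)) (levB : PBond (F.P K) (k + 1) → ℕ) (a : ℝ)
  (hposb : ∀ x, x ≠ 0 → 0 < RCLike.re ⟪x, laplaceAOfRecord F 2 (k + 1) (1 : GaugeField (F.P K) 0 (SU 2))
    (QOfRecord F 2 (k + 1) (1 : GaugeField (F.P K) 0 (SU 2))) (QflatOfRecord F 2 (k + 1)) a x⟫_ℂ)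
  (hQ : Function.Surjective (QOfRecord F 2 (k + 1) (1 : GaugeField (F.P K) 0 (SU 2)))) (a' : ℝ)
  (hpos' : haveI : CompleteSpace ↥(LinearMap.ker (QflatOfRecord F 2 (K := K) (k + 1)))ᗮ := FiniteDimensional.complete ℂ _
    ∀ x, x ≠ 0 → 0 < RCLike.re ⟪x, (covLaplaceSiteK (c₀ := c0Rec F K (k + 1)) (cRec F K (k + 1)) (RRec F 2 (1 : GaugeField (F.P K) 0 (SU 2)))
      (SRec F 2 (1 : GaugeField (F.P K) 0 (SU 2))) +
      (a' : ℂ) • ((LinearMap.ker (QflatOfRecord F 2 (K := K) (k + 1)))ᗮ.starProjection : _ →L[ℂ] _).toLinearMap) x⟫_ℂ)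

set_option maxHeartbeats 1600000 in
/-- ★★★★ **THE (R-a) ROAD AT THE FLAT SCHEME OF RECORD WITH PRINT's `G′`** — ✓`rootedReceipts_of_tokens_atScale_recordScheme_of_prop4W` at `G′ := (Δ_{U₀} + a′·proj_{N(Q′♭)ᗮ})⁻¹` (`greenK _ hpos'`), the
`G′` row supplied (✓`printGreenOfRecord_starW`, ✓`scalPartW_printGreenOfRecord`).  DISPLAYED: N07's KNIT tokens for the in-the-small scheme, (R2) `QuadAnalytic W C₄ a₃`, `0 < a₃ ≤ ε_C ≤ t₀`,
the `Δ2` tokens, the chart letter, (J-crit′)∕(J-cons′). [cite: Balaban1985BackgroundPropagators, (3.24)–(3.25) p.394, (3.134) p.422; Balaban1985Variational, Prop. 4 p.292, Prop. 6 p.295, Prop. 9 p.309] -/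
theorem rootedReceipts_of_tokens_atScale_recordScheme_of_prop4W_printGreen (hk2 : k + 2 ≤ (F.P K).m + (F.P K).K) :
    haveI : CompleteSpace ↥(LinearMap.ker (QflatOfRecord F 2 (K := K) (k + 1)))ᗮ := FiniteDimensional.complete ℂ _
    ∃ t₀ > 0, ∀ (Δ2 : BondL2K ℂ (F.P K).d (fun _ => (F.P K).sitesPerDir 0) (c0Rec F K (k + 1)) (WRec 2) →ₗ[ℂ]
        BondL2K ℂ (F.P K).d (fun _ => (F.P K).sitesPerDir 0) (c0Rec F K (k + 1)) (WRec 2))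
      (hposπ : ∀ x, x ≠ 0 → 0 < RCLike.re ⟪x, laplaceAOfRecordAt F 2 (k + 1) (1 : GaugeField (F.P K) 0 (SU 2))
        (hessOpOfRecord128 F 2 (k + 1) (1 : GaugeField (F.P K) 0 (SU 2)) (greenK _ hpos') (QflatOfRecord F 2 (k + 1)) Δ2)
        (QOfRecord F 2 (k + 1) (1 : GaugeField (F.P K) 0 (SU 2))) (QflatOfRecord F 2 (k + 1)) a x⟫_ℂ) (εC C₄ a₃ : ℝ),
      0 ≤ C₄ → 0 < a₃ → a₃ ≤ εC → εC ≤ t₀ →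
      QuadAnalytic (WOfRecordAt F 2 K (k + 1) Ω (1 : GaugeField (F.P K) 0 (SU 2)) levB a hposb hQ εC (greenK _ hpos')) C₄ a₃ →
      Delta2Tok F 2 K (k + 1) Ω 1 levB a hposb hQ Δ2 → Delta2SymmTok F 2 K (k + 1) Ω 1 Δ2 →
      (letI := θ.instVβ₁; letI := θ.instVβ₂; ∀ v : θ.Vβ, NormedSpace.exp (θ.ρ8 v) ∈ Matrix.specialUnitaryGroup (Fin 2) ℂ) →
      ∃ t > 0, ∀ (S : BgSchemeOnLit F 2 K (k + 1) Ω 1),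
        S = bgSchemeOfRecord F 2 K (k + 1) Ω 1
            {V : GaugeField (F.P K) (k + 1) (SU 2) | ‖frakAOfRecordAtBg128 F 2 K (k + 1) Ω (1 : GaugeField (F.P K) 0 (SU 2)) levB (greenK _ hpos') Δ2 a hposπ hQ V‖ < t}
            levB (greenK _ hpos') Δ2 a hposπ hposb hQ εC
            ‖frakGOfRecordAtBg128 F 2 K (k + 1) Ω (1 : GaugeField (F.P K) 0 (SU 2)) (greenK _ hpos') Δ2 a hposπ hQ‖ C₄ a₃ 0 t t →
        ∀ (Kc : GaugeField (F.P K) (k + 1) (SU 2) → Set (Space115Lit F 2 K (k + 1) Ω 1)),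
        (∀ V ∈ S.dom, ∀ A ∈ Kc V, S.chart V A ∈ bgReg F 2 K (k + 1) θ.εbg ∧ Averaging.iter (avOfRecord F 2 K) (k + 1) (S.chart V A) = V) →
        (∀ V ∈ S.dom, ∀ U : GaugeField (F.P K) 0 (SU 2), U ∈ bgReg F 2 K (k + 1) θ.εbg →
          Averaging.iter (avOfRecord F 2 K) (k + 1) U = V → ∃ A ∈ Kc V, OrbitRel (k + 1) (S.chart V A) U) →
        (∀ V ∈ S.dom, ∀ A ∈ Kc V, IsMinOn (wilsonAction4 ∘ S.chart V) (Kc V) A → ‖A‖ ≤ S.ε₄ ∧ mapT (S.𝒢 V) 0 (S.W V) (S.J V) (S.𝔄 V) A = A) →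
        (∀ V ∈ S.dom, S.sol V ∈ Kc V) → (∀ V ∈ S.dom, IsMinOn (wilsonAction4 ∘ S.chart V) (Kc V) (S.sol V)) →
        FlatCritDictionary F k K (msChart F 2 K (k + 1) (atScale (k + 1)) (avgFamily (avOfRecord F 2 K) 1) (1 : GaugeField (F.P K) 0 (SU 2))) →
        FlatConsDictionary F θ k K (msChart F 2 K (k + 1) (atScale (k + 1)) (avgFamily (avOfRecord F 2 K) 1) (1 : GaugeField (F.P K) 0 (SU 2)))
          (fun B => msChart F 2 K (k + 1) (atScale (k + 1)) (avgFamily (avOfRecord F 2 K) 1) (1 : GaugeField (F.P K) 0 (SU 2)) (S.lieExpo (unitField F θ k K B))) →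
        (∀ (a'' : θ.ιβ) (l : RespLabel F k K),
          RootedResponseCriticalModGaugeAt F θ k K a'' l ∧ RootedResponseOrbitAt F θ k K a'' l ∧
            RootedResponseInvCriticalAt F θ k K a'' l ∧ RootedResponseConstraintModGaugeAt F θ k K a'' l) ∧
        letI := θ.instVβ₁; letI := θ.instVβ₂
        ContDiffAt ℝ 2 (fun B : Fin (F.P K).d → Site (F.P K) (k + 1) → θ.Vβ =>
          fun (b : PBond (F.P K) 0) (i i' : Fin 2) => ((recordBgField F θ k K B b : SU 2) : Matrix (Fin 2) (Fin 2) ℂ) i i') 0 := by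
  haveI : CompleteSpace ↥(LinearMap.ker (QflatOfRecord F 2 (K := K) (k + 1)))ᗮ := FiniteDimensional.complete ℂ _
  haveI : (LinearMap.ker (QflatOfRecord F 2 (K := K) (k + 1))).HasOrthogonalProjection :=
    haveI : CompleteSpace ↥(LinearMap.ker (QflatOfRecord F 2 (K := K) (k + 1))) := FiniteDimensional.complete ℂ _
    inferInstance
  have hGpR := printGreenOfRecord_starW F 2 (k + 1) (1 : GaugeField (F.P K) 0 (SU 2)) a' hpos'
  have hGpS := scalPartW_printGreenOfRecord F 2 (k + 1) (1 : GaugeField (F.P K) 0 (SU 2)) a' hpos'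
  obtain ⟨t₀, ht₀, hroad⟩ := rootedReceipts_of_tokens_atScale_recordScheme_of_prop4W F θ k K Ω levB a hposb hQ hk2
  exact ⟨t₀, ht₀, fun Δ2 hposπ εC C₄ a₃ hC₄ ha₃ ha₃ε hεt hW hΔ hs hρ =>
    hroad (greenK _ hpos') Δ2 hposπ εC C₄ a₃ hC₄ ha₃ ha₃ε hεt hW hGpR hGpS hΔ hs hρ⟩

end Summit.QuantumFields.YangMills.Theorems.K0AxTangentSocketOntoOfProp4WPrintGreen

end
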